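import Literature.NumberTheory.Sieve.MaynardNFPrimes
import Literature.NumberTheory.Sieve.ResidueClassBoxCount
import Literature.NumberTheory.NumberFields.UnitsInBoxes
import HarnessLib

/-!
# The Maynard–Tao sieve over `𝓞_K`: the residue-class count behind `S₂^{(m)}` (Castillo et al., Lemma 2.3, first half)

Topic `Literature/NumberTheory/Sieve`. The number-field port of the tree's
`Sieve/MaynardSieveCounting2.lean` (first half of the proof of Maynard's Lemma 5.2), following
A. Castillo, C. Hall, R. J. Lemke Oliver, P. Pollack, L. Thompson, *Bounded gaps between primes in
number fields and function fields*, Proc. AMS 143 (2015) = arXiv:1403.5808, proof of Lemma 2.3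
(p. 8): "We begin by expanding out the square and swapping the order of summation … we rewrite the
inner sum over a single residue class modulo `𝔮 = 𝔴 ∏ [𝔡ᵢ, 𝔢ᵢ]` … The element `α + h_m` will lie
in a residue class coprime to the modulus if and only if `𝔡_m = 𝔢_m = 1` … we find that
`∑ χ_P(α + h_m) = |P(N)|/φ(𝔮) + O((|A(N)|/|𝔴∏[𝔡ᵢ,𝔢ᵢ]|)^{1−ν}) + O(𝓔(N; 𝔮, α₀))` (The first
`O`-term is needed in the number field case, since it is `α` that is restricted to `A(N)` instead
of `α + h_m`.)" Everything in this file is PROVED.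

* `chiP`, `S2 K k 𝔴 B y h ν₀ N m`, `cntP`; `S2_eq_sum_cntP`, `S2_eq_sum_boxG` (expand the square),
  `cntP_le_cnt`, `cntP_eq_zero_of_not_coprime` (incompatible pairs);
* **the slot `m`** — a number-field phenomenon absent over `ℤ`: a prime `α + h_m` lying in a proper
  ideal `𝔡_m` GENERATES `𝔡_m`, so such `α` are counted by the generators of a fixed ideal in a box:
  `GeneratorCount` / `exists_generatorCount` (`UnitsInBoxes.card_generators_mem_box_le` as a
  hypothesis on a constant), `cntP_le_of_apply_ne_top`, `cntP_le_of_apply_ne_top'`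
  (`cntP ≤ C_u (1 + log((2 + c)N))^{r₁+r₂−1}` when `𝔡_m ≠ (1)` or `𝔢_m ≠ (1)`);
* `sup_span_add_eq_top` — for `𝔡_m = 𝔢_m = (1)` the CRT class `a + h_m` is coprime to `𝔮`
  ("Based on our choice of `v₀ (mod 𝔴)`", plus "`P ∣ hᵢ − hⱼ ⇒ P ∣ 𝔴`");
* `ShiftBound` / `exists_shiftBound` (`ResidueClassBoxCount.card_xor_box_shift_coset_le` as a
  hypothesis on a constant), `abs_card_sub_card_le_of_shift`, **`abs_cntP_sub_le`** — the displayed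
  formula: `|cntP − |P(N)|/φ(𝔮)| ≤ 𝓔(N; 𝔮) + C_s (N^{d−1}/N𝔮 + 1 + (N^d/N𝔮)^{1−1/d})`;
* `pairErr`, **`abs_S2_sub_bilinear_le`** (display (eq:S2mainerror)), and with the diagonalisation
  `MaynardNFBilinear.abs_S2main_sub_le` the combinatorial Lemma 2.3 **`abs_S2_sub_main_le`**:
  `|S₂^{(m)} − (|P(N)|/φ(𝔴)) ∑_𝔲 (y^{(m)}_𝔲)²/∏g(𝔲ᵢ)| ≤ (|P(N)|/φ(𝔴)) (y^{(m)}_max)² L_g^{k−1}(Z_g^K − 1)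
   + ∑_{𝔡,𝔢} |λ_𝔡λ_𝔢| pairErr(𝔡,𝔢)`.

The regrouping of the error by the modulus and the level-of-distribution step (`PrimesHaveLevel`)
are the sequel.

## References

* Castillo–Hall–Lemke Oliver–Pollack–Thompson, arXiv:1403.5808, §2.2, proof of Lemma 2.3 (p. 8,
  displays up to (eq:S2mainerror)). [CastilloEtAl2015]
* J. Maynard, *Small gaps between primes*, Ann. of Math. 181 (2015), proof of Lemma 5.2,
  (5.16)–(5.17). [MaynardAnnals2015]
-/

noncomputable section

open Finset UniqueFactorizationMonoid IsDedekindDomain NumberField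
open scoped NumberField Classical

namespace Literature.NumberTheory.Sieve.MaynardNF

open UniqueFactorizationMonoid Literature.NumberTheory.LFunctions
  Literature.NumberTheory.LFunctions.NumberField Module

open scoped nonZeroDivisors

variable {K : Type*} [Field K] [NumberField K]
variable {k : ℕ}

/-! ### `S₂^{(m)}` and its expansion -/

/-- The prime indicator `χ_P` (`P` = the prime elements of `𝓞_K`). [cite: CastilloEtAl2015, §2.2 (χ_P)] -/
def chiP (β : 𝓞 K) : ℝ := if Prime β then 1 else 0

omit [NumberField K] in
/-- `χ_P ∈ {0, 1}`. [folklore] -/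
theorem chiP_eq_ite (β : 𝓞 K) : chiP β = if Prime β then 1 else 0 := rfl

variable (K) in
/-- The component sum `S₂^{(m)} = ∑_{α ∈ A(N), α ≡ ν₀ (𝔴)} χ_P(α + h_m) (∑_{𝔡ᵢ ∣ (α+hᵢ) ∀i} λ_𝔡)²` of
Castillo et al. §2.2 for the weights `λ = lam B y`, the `𝔡ᵢ` running over the box.
[cite: CastilloEtAl2015, §2.2 (definition of S₂^(m))] -/
def S2 (k : ℕ) (𝔴 : Ideal (𝓞 K)) (B : ℝ) (y : (Fin k → Ideal (𝓞 K)) → ℝ) (h : Fin k → 𝓞 K)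
    (ν₀ : 𝓞 K) (N : ℝ) (m : Fin k) : ℝ :=
  ∑ α ∈ (regionF K N).filter (fun α => α - ν₀ ∈ 𝔴),
    chiP (α + h m) * (∑ 𝔡 ∈ (box K k B).filter (fun 𝔡 => ∀ i, α + h i ∈ 𝔡 i), lam K k B y 𝔡) ^ 2

variable (K) in
/-- The inner count after expanding the square:
`#{α ∈ A(N) : α ≡ ν₀ (𝔴), α + hᵢ ∈ 𝔡ᵢ ∩ 𝔢ᵢ ∀ i, α + h_m prime}`. [cite: CastilloEtAl2015, proof of Lemma 2.3 (first display)] -/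
def cntP (𝔴 : Ideal (𝓞 K)) (h : Fin k → 𝓞 K) (ν₀ : 𝓞 K) (N : ℝ) (m : Fin k)
    (𝔡 𝔢 : Fin k → Ideal (𝓞 K)) : ℕ :=
  ((regionF K N).filter fun α => α - ν₀ ∈ 𝔴 ∧ (∀ i, α + h i ∈ 𝔡 i ∧ α + h i ∈ 𝔢 i) ∧
    Prime (α + h m)).card

/-- **Expanding the square**: `S₂^{(m)} = ∑_{𝔡, 𝔢} λ_𝔡 λ_𝔢 cntP(𝔡, 𝔢)`.
[cite: CastilloEtAl2015, proof of Lemma 2.3 (first display)] -/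
theorem S2_eq_sum_cntP (𝔴 : Ideal (𝓞 K)) (B : ℝ) (y : (Fin k → Ideal (𝓞 K)) → ℝ) (h : Fin k → 𝓞 K)
    (ν₀ : 𝓞 K) (N : ℝ) (m : Fin k) :
    S2 K k 𝔴 B y h ν₀ N m =
      ∑ 𝔡 ∈ box K k B, ∑ 𝔢 ∈ box K k B,
        lam K k B y 𝔡 * lam K k B y 𝔢 * (cntP K 𝔴 h ν₀ N m 𝔡 𝔢 : ℝ) := by
  classical
  unfold S2
  have hsq : ∀ α : 𝓞 K,
      chiP (α + h m) * (∑ 𝔡 ∈ (box K k B).filter (fun 𝔡 => ∀ i, α + h i ∈ 𝔡 i), lam K k B y 𝔡) ^ 2 =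
        ∑ 𝔡 ∈ box K k B, ∑ 𝔢 ∈ box K k B,
          if ((∀ i, α + h i ∈ 𝔡 i ∧ α + h i ∈ 𝔢 i) ∧ Prime (α + h m)) then
            lam K k B y 𝔡 * lam K k B y 𝔢 else 0 := by
    intro α
    rw [sq, Finset.sum_filter, Finset.sum_mul_sum, Finset.mul_sum]
    refine Finset.sum_congr rfl fun 𝔡 _ => ?_
    rw [Finset.mul_sum]
    refine Finset.sum_congr rfl fun 𝔢 _ => ?_
    rw [chiP_eq_ite]
    by_cases hd : ∀ i, α + h i ∈ 𝔡 i <;> by_cases he : ∀ i, α + h i ∈ 𝔢 i <;>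
      by_cases hp : Prime (α + h m) <;> simp [hd, he, hp, forall_and]
  simp_rw [hsq]
  rw [Finset.sum_comm]
  refine Finset.sum_congr rfl fun 𝔡 _ => ?_
  rw [Finset.sum_comm]
  refine Finset.sum_congr rfl fun 𝔢 _ => ?_
  rw [← Finset.sum_filter, Finset.filter_filter, Finset.sum_const, nsmul_eq_mul, mul_comm]
  rfl

/-- Only good tuples contribute (`λ_𝔡 = 0` off `boxG`). [cite: CastilloEtAl2015, proof of Lemma 2.3] -/
theorem S2_eq_sum_boxG {𝔴 : Ideal (𝓞 K)} {B : ℝ} {y : (Fin k → Ideal (𝓞 K)) → ℝ}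
    (hy : SupportedOn K k 𝔴 B y) (h : Fin k → 𝓞 K) (ν₀ : 𝓞 K) (N : ℝ) (m : Fin k) :
    S2 K k 𝔴 B y h ν₀ N m =
      ∑ 𝔡 ∈ boxG K k 𝔴 B, ∑ 𝔢 ∈ boxG K k 𝔴 B,
        lam K k B y 𝔡 * lam K k B y 𝔢 * (cntP K 𝔴 h ν₀ N m 𝔡 𝔢 : ℝ) := by
  rw [S2_eq_sum_cntP]
  have hsub : boxG K k 𝔴 B ⊆ box K k B := Finset.filter_subset _ _
  symm
  rw [Finset.sum_subset hsub fun 𝔡 _ hd => ?_]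
  · refine Finset.sum_congr rfl fun 𝔡 _ => Finset.sum_subset hsub fun 𝔢 _ he => ?_
    rw [lam_eq_zero_of_not hy he, mul_zero, zero_mul]
  · exact Finset.sum_eq_zero fun 𝔢 _ => by rw [lam_eq_zero_of_not hy hd, zero_mul, zero_mul]

/-- The prime count is at most the plain count. [folklore] -/
theorem cntP_le_cnt (𝔴 : Ideal (𝓞 K)) (h : Fin k → 𝓞 K) (ν₀ : 𝓞 K) (N : ℝ) (m : Fin k)
    (𝔡 𝔢 : Fin k → Ideal (𝓞 K)) : cntP K 𝔴 h ν₀ N m 𝔡 𝔢 ≤ cnt K 𝔴 h ν₀ N 𝔡 𝔢 := by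
  unfold cntP cnt
  exact Finset.card_le_card (Finset.monotone_filter_right _ fun α _ hα => ⟨hα.1, hα.2.1⟩)

/-- **Incompatible pairs count nothing** (as for `S₁`). [cite: CastilloEtAl2015, proof of Lemma 2.3] -/
theorem cntP_eq_zero_of_not_coprime {𝔴 : Ideal (𝓞 K)} {h : Fin k → 𝓞 K}
    (hh : ∀ i j, i ≠ j → ∀ P : Ideal (𝓞 K), P.IsPrime → h i - h j ∈ P → P ∣ 𝔴) (ν₀ : 𝓞 K) (N : ℝ)
    (m : Fin k) {𝔡 𝔢 : Fin k → Ideal (𝓞 K)} (hd : IsGood 𝔴 𝔡) {p : OffDiag k}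
    (hp : ¬ 𝔡 p.1.1 ⊔ 𝔢 p.1.2 = ⊤) : cntP K 𝔴 h ν₀ N m 𝔡 𝔢 = 0 := by
  have := cntP_le_cnt 𝔴 h ν₀ N m 𝔡 𝔢
  rw [cnt_eq_zero_of_not_coprime hh ν₀ N hd hp] at this
  omega

/-- `cntP` is symmetric in `(𝔡, 𝔢)`. [folklore] -/
theorem cntP_comm (𝔴 : Ideal (𝓞 K)) (h : Fin k → 𝓞 K) (ν₀ : 𝓞 K) (N : ℝ) (m : Fin k)
    (𝔡 𝔢 : Fin k → Ideal (𝓞 K)) : cntP K 𝔴 h ν₀ N m 𝔡 𝔢 = cntP K 𝔴 h ν₀ N m 𝔢 𝔡 := by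
  unfold cntP
  congr 1
  refine Finset.filter_congr fun α _ => ?_
  exact ⟨fun ⟨h1, h2, h3⟩ => ⟨h1, fun i => ⟨(h2 i).2, (h2 i).1⟩, h3⟩,
    fun ⟨h1, h2, h3⟩ => ⟨h1, fun i => ⟨(h2 i).2, (h2 i).1⟩, h3⟩⟩

/-! ### The slot `m`: a prime `α + h_m` in a proper ideal `𝔡_m` generates it -/

variable (K) in
/-- The count of generators of a fixed ideal in a box
(`Literature.NumberTheory.NumberFields.card_generators_mem_box_le`) as a hypothesis on a constant
`C`: every finite set of generators `y` of one ideal `I` with all `w(y) ≤ T` (`T ≥ 1`) has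
`≤ C (1 + log T)^{rank 𝓞_Kˣ}` elements. [folklore] -/
def GeneratorCount (C : ℝ) : Prop :=
  ∀ (I : Ideal (𝓞 K)) (T : ℝ), 1 ≤ T → ∀ s : Finset (𝓞 K),
    (∀ y ∈ s, Ideal.span {y} = I ∧ ∀ w : InfinitePlace K, w (y : K) ≤ T) →
      (s.card : ℝ) ≤ C * (1 + Real.log T) ^ Units.rank K

/-- Such a constant exists (Dirichlet's unit theorem). [folklore] -/
theorem exists_generatorCount : ∃ C : ℝ, 1 ≤ C ∧ GeneratorCount K C := by
  obtain ⟨C, hC1, hC⟩ := Literature.NumberTheory.NumberFields.card_generators_mem_box_le K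
  exact ⟨C, hC1, fun I T hT s hs => hC I T hT s hs⟩

/-- A prime element lying in a proper ideal of a Dedekind domain generates it. [folklore] -/
theorem span_singleton_eq_of_prime_of_mem {I : Ideal (𝓞 K)} (hI : I ≠ ⊤) {π : 𝓞 K} (hπ : Prime π)
    (hmem : π ∈ I) : Ideal.span {π} = I := by
  have hprime : (Ideal.span ({π} : Set (𝓞 K))).IsPrime := (Ideal.span_singleton_prime hπ.ne_zero).2 hπ
  have hne : Ideal.span ({π} : Set (𝓞 K)) ≠ ⊥ := by
    rw [Ne, Ideal.span_singleton_eq_bot]; exact hπ.ne_zero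
  have hmax : (Ideal.span ({π} : Set (𝓞 K))).IsMaximal := hprime.isMaximal hne
  exact hmax.eq_of_le hI ((Ideal.span_singleton_le_iff_mem _).2 hmem)

/-- For `α ∈ A(N)` (totally real `K`, `N ≥ 1`) and any `h`: `w(α + h) ≤ (2 + c(h)) N` at every
infinite place, `c(h) = CastilloEtAl2015.shiftConst`. [folklore] -/
theorem apply_add_le_of_mem_box [IsTotallyReal K] {N : ℝ} (hN : 1 ≤ N) {α : 𝓞 K}
    (hα : α ∈ CastilloEtAl2015.box K N) (h : 𝓞 K) (w : InfinitePlace K) :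
    w ((α + h : 𝓞 K) : K) ≤ (2 + CastilloEtAl2015.shiftConst K h) * N := by
  set w' : {w : InfinitePlace K // w.IsReal} := ⟨w, IsTotallyReal.isReal w⟩
  have hαw : w (α : K) ≤ 2 * N := by
    have h1 : α ∈ CastilloEtAl2015.cbox K (fun _ => 0) (fun _ => 2 * N) := by
      rw [← CastilloEtAl2015.box₀_eq_cbox]; exact hα.1
    have h2 := (CastilloEtAl2015.mem_cbox_iff_realEmb.1 h1) w'
    rw [← CastilloEtAl2015.abs_realEmb K α w']
    rw [Set.mem_Ioc] at h2
    rw [abs_le]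
    constructor <;> linarith [h2.1, h2.2]
  have hhw : w (h : K) ≤ CastilloEtAl2015.shiftConst K h := by
    rw [← CastilloEtAl2015.abs_realEmb K h w']
    exact (CastilloEtAl2015.abs_realEmb_lt_shiftConst K h w').le
  have hc0 : 0 ≤ CastilloEtAl2015.shiftConst K h := le_trans (apply_nonneg _ _) hhw
  calc w ((α + h : 𝓞 K) : K) = w ((α : K) + (h : K)) := by simp
    _ ≤ w (α : K) + w (h : K) := w.1.add_le _ _
    _ ≤ 2 * N + CastilloEtAl2015.shiftConst K h := add_le_add hαw hhw
    _ ≤ (2 + CastilloEtAl2015.shiftConst K h) * N := by nlinarith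

/-- **The slot `m` (number-field case)**: if `𝔡_m ≠ (1)`, then
`cntP(𝔡, 𝔢) ≤ C_u (1 + log((2 + c(h_m)) N))^{rank 𝓞_Kˣ}` — every counted `α` has `α + h_m` a prime
element of the proper ideal `𝔡_m`, hence a generator of `𝔡_m`, lying in a box of size
`(2 + c)N`; such generators differ by units and are counted by `GeneratorCount`. (Over `ℤ` this
count is `0` once `N > R`; over `𝓞_K` the box `A(N)` contains elements of small norm, and the
count is only polylogarithmic.) [cite: CastilloEtAl2015, proof of Lemma 2.3 ("the only case that yields a contribution")] -/
theorem cntP_le_of_apply_ne_top [IsTotallyReal K] {C_u : ℝ} (hCu : GeneratorCount K C_u)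
    (𝔴 : Ideal (𝓞 K)) (h : Fin k → 𝓞 K) (ν₀ : 𝓞 K) {N : ℝ} (hN : 1 ≤ N) (m : Fin k)
    {𝔡 : Fin k → Ideal (𝓞 K)} (hdm : 𝔡 m ≠ ⊤) (𝔢 : Fin k → Ideal (𝓞 K)) :
    (cntP K 𝔴 h ν₀ N m 𝔡 𝔢 : ℝ) ≤
      C_u * (1 + Real.log ((2 + CastilloEtAl2015.shiftConst K (h m)) * N)) ^ Units.rank K := by
  set S := (regionF K N).filter fun α => α - ν₀ ∈ 𝔴 ∧ (∀ i, α + h i ∈ 𝔡 i ∧ α + h i ∈ 𝔢 i) ∧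
    Prime (α + h m) with hS
  have hcard : cntP K 𝔴 h ν₀ N m 𝔡 𝔢 = (S.image fun α => α + h m).card := by
    rw [Finset.card_image_of_injective _ (add_left_injective (h m))]
    rfl
  have hc1 : 1 ≤ CastilloEtAl2015.shiftConst K (h m) := CastilloEtAl2015.one_le_shiftConst K (h m)
  have hT : 1 ≤ (2 + CastilloEtAl2015.shiftConst K (h m)) * N := by nlinarith
  rw [hcard]
  refine hCu (𝔡 m) _ hT _ fun y hy => ?_
  rw [Finset.mem_image] at hy
  obtain ⟨α, hα, rfl⟩ := hy
  rw [hS, Finset.mem_filter, mem_regionF] at hα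
  obtain ⟨hαbox, -, hdiv, hprime⟩ := hα
  exact ⟨span_singleton_eq_of_prime_of_mem hdm hprime (hdiv m).1,
    fun w => apply_add_le_of_mem_box hN hαbox (h m) w⟩

/-- The symmetric statement for `𝔢_m ≠ (1)`. [cite: CastilloEtAl2015, proof of Lemma 2.3] -/
theorem cntP_le_of_apply_ne_top' [IsTotallyReal K] {C_u : ℝ} (hCu : GeneratorCount K C_u)
    (𝔴 : Ideal (𝓞 K)) (h : Fin k → 𝓞 K) (ν₀ : 𝓞 K) {N : ℝ} (hN : 1 ≤ N) (m : Fin k)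
    (𝔡 : Fin k → Ideal (𝓞 K)) {𝔢 : Fin k → Ideal (𝓞 K)} (hem : 𝔢 m ≠ ⊤) :
    (cntP K 𝔴 h ν₀ N m 𝔡 𝔢 : ℝ) ≤
      C_u * (1 + Real.log ((2 + CastilloEtAl2015.shiftConst K (h m)) * N)) ^ Units.rank K := by
  rw [cntP_comm]
  exact cntP_le_of_apply_ne_top hCu 𝔴 h ν₀ hN m hem 𝔡

/-! ### The class of `α + h_m` is coprime to the modulus -/

omit [NumberField K] in
/-- **"`α + h_m` lies in a class coprime to the modulus iff `𝔡_m = 𝔢_m = 1` … Based on our choice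
of `v₀`"**: if `a` is the CRT class (`α ≡ ν₀ (𝔴)`, `α + hᵢ ∈ Lᵢ := 𝔡ᵢ ∩ 𝔢ᵢ` `⟺` `α ≡ a (𝔮)`,
`𝔮 = 𝔴 ∏ Lᵢ`), `L_m = (1)`, `(ν₀ + h_m) + 𝔴 = (1)`, every prime ideal containing some `hᵢ − hⱼ`
(`i ≠ j`) divides `𝔴`, and each `Lᵢ` is comaximal with `𝔴`, then `(a + h_m) + 𝔮 = (1)`.
[cite: CastilloEtAl2015, proof of Lemma 2.3] -/
theorem sup_span_add_eq_top {𝔴 : Ideal (𝓞 K)} {h : Fin k → 𝓞 K}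
    (hh : ∀ i j, i ≠ j → ∀ P : Ideal (𝓞 K), P.IsPrime → h i - h j ∈ P → P ∣ 𝔴)
    {ν₀ : 𝓞 K} {m : Fin k} (hν₀ : Ideal.span {ν₀ + h m} ⊔ 𝔴 = ⊤)
    {L : Fin k → Ideal (𝓞 K)} (hLW : ∀ i, L i ⊔ 𝔴 = ⊤) (hLm : L m = ⊤) {a : 𝓞 K}
    (ha𝔴 : a - ν₀ ∈ 𝔴) (haL : ∀ i, a + h i ∈ L i) :
    Ideal.span {a + h m} ⊔ (𝔴 * ∏ i, L i) = ⊤ := by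
  by_contra hne
  obtain ⟨P, hPmax, hle⟩ := Ideal.exists_le_maximal _ hne
  have hPprime := hPmax.isPrime
  have haP : a + h m ∈ P := hle (Ideal.mem_sup_left (Ideal.mem_span_singleton_self _))
  have hqP : 𝔴 * ∏ i, L i ≤ P := le_trans le_sup_right hle
  rcases hPprime.mul_le.1 hqP with h𝔴P | hLP
  · -- `P ⊇ 𝔴`: then `ν₀ + h_m ∈ P`
    have h1 : ν₀ + h m ∈ P := by
      have : ν₀ + h m = (a + h m) - (a - ν₀) := by ring
      rw [this]
      exact P.sub_mem haP (h𝔴P ha𝔴)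
    have : Ideal.span {ν₀ + h m} ⊔ 𝔴 ≤ P :=
      sup_le ((Ideal.span_singleton_le_iff_mem _).2 h1) h𝔴P
    rw [hν₀, top_le_iff] at this
    exact hPmax.ne_top this
  · obtain ⟨i, -, hi⟩ := (hPprime.prod_le).1 hLP
    by_cases him : i = m
    · subst him
      rw [hLm, top_le_iff] at hi
      exact hPmax.ne_top hi
    · have h1 : h m - h i ∈ P := by
        have : h m - h i = (a + h m) - (a + h i) := by ring
        rw [this]
        exact P.sub_mem haP (hi (haL i))
      have h𝔴P : 𝔴 ≤ P := Ideal.le_of_dvd (hh m i (Ne.symm him) P hPprime h1)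
      have : L i ⊔ 𝔴 ≤ P := sup_le hi h𝔴P
      rw [hLW i, top_le_iff] at this
      exact hPmax.ne_top this

/-! ### The count in one residue class: `|P(N)|/φ(𝔮) + O(shift) + O(𝓔(N;𝔮))` -/

variable (K) in
/-- The shift estimate of `ResidueClassBoxCount.card_xor_box_shift_coset_le` for the element `h₀`,
as a hypothesis on a constant `C`. [cite: CastilloEtAl2015, proof of Lemma 2.3 (first O-term)] -/
def ShiftBound (h₀ : 𝓞 K) (C : ℝ) : Prop :=
  ∀ (𝔮 : (Ideal (𝓞 K))⁰) (N : ℝ), 1 ≤ N → ∀ a : 𝓞 K,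
    (Nat.card {β : 𝓞 K // Xor (β ∈ CastilloEtAl2015.box K N) (β - h₀ ∈ CastilloEtAl2015.box K N) ∧
        β - a ∈ (𝔮 : Ideal (𝓞 K))} : ℝ) ≤
      C * (N ^ (finrank ℚ K - 1) / Ideal.absNorm (𝔮 : Ideal (𝓞 K)) +
        (1 + (N ^ finrank ℚ K / Ideal.absNorm (𝔮 : Ideal (𝓞 K))) ^ (1 - 1 / (finrank ℚ K : ℝ))))

/-- Such a constant exists for totally real `K`. [cite: CastilloEtAl2015, proof of Lemma 2.3 (first O-term)] -/
theorem exists_shiftBound [IsTotallyReal K] (h₀ : 𝓞 K) : ∃ C : ℝ, ShiftBound K h₀ C :=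
  CastilloEtAl2015.card_xor_box_shift_coset_le K h₀

omit [NumberField K] in
/-- `|#A − #B| ≤ #(A ∆ B)` for finsets. [folklore] -/
theorem abs_card_sub_card_le_card_symmDiff (A B : Finset (𝓞 K)) :
    |(A.card : ℝ) - B.card| ≤ ((A \ B).card : ℝ) + (B \ A).card := by
  have h1 : (A.card : ℝ) = (A \ B).card + (A ∩ B).card := by
    exact_mod_cast (Finset.card_sdiff_add_card_inter A B).symm
  have h2 : (B.card : ℝ) = (B \ A).card + (B ∩ A).card := by
    exact_mod_cast (Finset.card_sdiff_add_card_inter B A).symm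
  rw [h1, h2, Finset.inter_comm B A, abs_le]
  constructor <;> linarith [(Nat.cast_nonneg (α := ℝ) (A \ B).card), (Nat.cast_nonneg (α := ℝ) (B \ A).card)]

/-- **The shift**: `|#{α ∈ A(N) : α ≡ a (𝔮), α + h₀ prime} − #{π ∈ P(N) : π ≡ a + h₀ (𝔮)}| ≤ shift`
— both sides count primes `β ≡ a + h₀`, on `A(N) + h₀` resp. `A(N)`, and the symmetric difference
of these regions within the class is bounded by `ShiftBound`.
[cite: CastilloEtAl2015, proof of Lemma 2.3 (first O-term)] -/
theorem abs_card_sub_card_le_of_shift {h₀ : 𝓞 K} {C_s : ℝ} (hCs : ShiftBound K h₀ C_s)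
    {𝔮 : Ideal (𝓞 K)} (h𝔮 : 𝔮 ≠ ⊥) {N : ℝ} (hN : 1 ≤ N) (a : 𝓞 K) :
    |((((regionF K N).filter fun α => α - a ∈ 𝔮 ∧ Prime (α + h₀)).card : ℝ)) -
        ((regionF K N).filter fun π => Prime π ∧ π - (a + h₀) ∈ 𝔮).card| ≤
      C_s * (N ^ (finrank ℚ K - 1) / Ideal.absNorm 𝔮 +
        (1 + (N ^ finrank ℚ K / Ideal.absNorm 𝔮) ^ (1 - 1 / (finrank ℚ K : ℝ)))) := by
  set T₁ := (regionF K N).filter fun α => α - a ∈ 𝔮 ∧ Prime (α + h₀) with hT₁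
  set T₂ := (regionF K N).filter fun π => Prime π ∧ π - (a + h₀) ∈ 𝔮 with hT₂
  set T₁' := T₁.image fun α => α + h₀ with hT₁'
  have hcard₁ : (T₁.card : ℝ) = T₁'.card := by
    rw [hT₁', Finset.card_image_of_injective _ (add_left_injective h₀)]
  -- both symmetric differences lie in the exceptional set
  set X : Set (𝓞 K) := {β | Xor (β ∈ CastilloEtAl2015.box K N) (β - h₀ ∈ CastilloEtAl2015.box K N) ∧
    β - (a + h₀) ∈ 𝔮} with hX
  have hmem₁' : ∀ β, β ∈ T₁' ↔ β - h₀ ∈ CastilloEtAl2015.box K N ∧ β - (a + h₀) ∈ 𝔮 ∧ Prime β := by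
    intro β
    rw [hT₁', Finset.mem_image]
    constructor
    · rintro ⟨α, hα, rfl⟩
      rw [hT₁, Finset.mem_filter, mem_regionF] at hα
      refine ⟨by simpa using hα.1, ?_, hα.2.2⟩
      have : α + h₀ - (a + h₀) = α - a := by ring
      rw [this]; exact hα.2.1
    · rintro ⟨hb, hq, hp⟩
      refine ⟨β - h₀, ?_, by simp⟩
      rw [hT₁, Finset.mem_filter, mem_regionF]
      refine ⟨hb, ?_, by simpa using hp⟩
      have : β - h₀ - a = β - (a + h₀) := by ring
      rw [this]; exact hq
  have hmem₂ : ∀ β, β ∈ T₂ ↔ β ∈ CastilloEtAl2015.box K N ∧ β - (a + h₀) ∈ 𝔮 ∧ Prime β := by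
    intro β
    rw [hT₂, Finset.mem_filter, mem_regionF]
    tauto
  have hX₁ : ∀ β ∈ T₁' \ T₂, β ∈ X := by
    intro β hβ
    rw [Finset.mem_sdiff, hmem₁', hmem₂] at hβ
    obtain ⟨⟨hb, hq, hp⟩, hn⟩ := hβ
    refine ⟨Or.inr ⟨hb, fun hb' => hn ⟨hb', hq, hp⟩⟩, hq⟩
  have hX₂ : ∀ β ∈ T₂ \ T₁', β ∈ X := by
    intro β hβ
    rw [Finset.mem_sdiff, hmem₂, hmem₁'] at hβ
    obtain ⟨⟨hb, hq, hp⟩, hn⟩ := hβ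
    refine ⟨Or.inl ⟨hb, fun hb' => hn ⟨hb', hq, hp⟩⟩, hq⟩
  have hXfin : X.Finite := by
    refine ((CastilloEtAl2015.finite_box N).union ((CastilloEtAl2015.finite_box N).image
      (fun β => β + h₀))).subset ?_
    intro β hβ
    rcases hβ.1.or with hb | hb
    · exact Or.inl hb
    · exact Or.inr ⟨β - h₀, hb, by simp⟩
  have hdisj : Disjoint (T₁' \ T₂) (T₂ \ T₁') :=
    Finset.disjoint_left.2 fun β h1 h2 => (Finset.mem_sdiff.1 h1).2 (Finset.mem_sdiff.1 h2).1
  have hunion : (T₁' \ T₂) ∪ (T₂ \ T₁') ⊆ hXfin.toFinset := by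
    intro β hβ
    rw [Set.Finite.mem_toFinset]
    rcases Finset.mem_union.1 hβ with h | h
    · exact hX₁ β h
    · exact hX₂ β h
  have hle : (((T₁' \ T₂).card : ℝ)) + (T₂ \ T₁').card ≤ Nat.card X := by
    have h1 : ((T₁' \ T₂) ∪ (T₂ \ T₁')).card ≤ hXfin.toFinset.card := Finset.card_le_card hunion
    rw [Finset.card_union_of_disjoint hdisj] at h1
    have h2 : Nat.card X = hXfin.toFinset.card := by
      rw [Nat.card_coe_set_eq, Set.ncard_eq_toFinset_card _ hXfin]
    rw [h2]
    exact_mod_cast h1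
  have hq0 : 𝔮 ∈ (Ideal (𝓞 K))⁰ := mem_nonZeroDivisors_of_ne_zero (by rwa [Ne, Ideal.zero_eq_bot])
  have hshift := hCs ⟨𝔮, hq0⟩ N hN (a + h₀)
  simp only at hshift
  rw [hcard₁]
  exact ((abs_card_sub_card_le_card_symmDiff T₁' T₂).trans hle).trans hshift

/-- **The inner sum contributes `|P(N)|/φ(𝔮) + O((|A(N)|/|𝔮|)^{1−ν}) + O(𝓔(N; 𝔮))`** (proof of
Lemma 2.3, the displayed formula, totally real `K`): for good `𝔡, 𝔢` with `(𝔡ᵢ, 𝔢ⱼ) = 1` (`i ≠ j`),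
`𝔡_m = 𝔢_m = (1)`, `(ν₀ + h_m) + 𝔴 = (1)`, every prime ideal containing some `hᵢ − hⱼ` dividing
`𝔴`, `𝔴 ≠ 0` and `N ≥ 1`: with `𝔮 = 𝔴 ∏ [𝔡ᵢ, 𝔢ᵢ]`, `N𝔮 = N𝔴 ∏ N[𝔡ᵢ,𝔢ᵢ]`,
`|cntP(𝔡, 𝔢) − |P(N)|/φ(𝔮)| ≤ 𝓔(N; 𝔮) + C_s (N^{d−1}/N𝔮 + 1 + (N^d/N𝔮)^{1−1/d})`.
[cite: CastilloEtAl2015, proof of Lemma 2.3 (the display for ∑ χ_P(α + h_m))] -/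
theorem abs_cntP_sub_le {𝔴 : Ideal (𝓞 K)} (h𝔴 : 𝔴 ≠ ⊥) {h : Fin k → 𝓞 K}
    (hh : ∀ i j, i ≠ j → ∀ P : Ideal (𝓞 K), P.IsPrime → h i - h j ∈ P → P ∣ 𝔴)
    {ν₀ : 𝓞 K} {m : Fin k} (hν₀ : Ideal.span {ν₀ + h m} ⊔ 𝔴 = ⊤) {C_s : ℝ}
    (hCs : ShiftBound K (h m) C_s) {N : ℝ} (hN : 1 ≤ N)
    {𝔡 𝔢 : Fin k → Ideal (𝓞 K)} (hd : IsGood 𝔴 𝔡) (he : IsGood 𝔴 𝔢)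
    (hc : ∀ p : OffDiag k, 𝔡 p.1.1 ⊔ 𝔢 p.1.2 = ⊤) (hdm : 𝔡 m = ⊤) (hem : 𝔢 m = ⊤) :
    |(cntP K 𝔴 h ν₀ N m 𝔡 𝔢 : ℝ) -
        primesA K N / idealTotient K (𝔴 * ∏ i, (𝔡 i ⊓ 𝔢 i))| ≤
      primesAErr K N (𝔴 * ∏ i, (𝔡 i ⊓ 𝔢 i)) +
        C_s * (N ^ (finrank ℚ K - 1) / Ideal.absNorm (𝔴 * ∏ i, (𝔡 i ⊓ 𝔢 i)) +
          (1 + (N ^ finrank ℚ K / Ideal.absNorm (𝔴 * ∏ i, (𝔡 i ⊓ 𝔢 i))) ^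
            (1 - 1 / (finrank ℚ K : ℝ)))) := by
  classical
  obtain ⟨a, hiff, hq0, -, hLW, -⟩ := exists_crt_class h𝔴 hd he hc h ν₀
  set 𝔮 : Ideal (𝓞 K) := 𝔴 * ∏ i, (𝔡 i ⊓ 𝔢 i) with hq
  -- the class `a`: `a ≡ ν₀ (𝔴)`, `a + hᵢ ∈ Lᵢ`
  have ha := (hiff a).2 (by simp)
  have hcop : Ideal.span {a + h m} ⊔ 𝔮 = ⊤ :=
    sup_span_add_eq_top hh hν₀ hLW (by rw [hdm, hem]; simp) ha.1 fun i => by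
      exact ⟨(ha.2 i).1, (ha.2 i).2⟩
  -- `cntP` through the class
  have hcnt : cntP K 𝔴 h ν₀ N m 𝔡 𝔢 =
      ((regionF K N).filter fun α => α - a ∈ 𝔮 ∧ Prime (α + h m)).card := by
    unfold cntP
    congr 1
    refine Finset.filter_congr fun α _ => ?_
    rw [← and_assoc, hiff α]
  have h1 := abs_card_sub_card_le_of_shift hCs hq0 hN a
  have h2 := abs_sub_le_primesAErr hq0 N hcop
  rw [hcnt]
  calc |((((regionF K N).filter fun α => α - a ∈ 𝔮 ∧ Prime (α + h m)).card : ℝ)) -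
        primesA K N / idealTotient K 𝔮|
      ≤ |((((regionF K N).filter fun α => α - a ∈ 𝔮 ∧ Prime (α + h m)).card : ℝ)) -
          ((regionF K N).filter fun π => Prime π ∧ π - (a + h m) ∈ 𝔮).card| +
        |((((regionF K N).filter fun π => Prime π ∧ π - (a + h m) ∈ 𝔮).card : ℝ)) -
          primesA K N / idealTotient K 𝔮| := abs_sub_le _ _ _
    _ ≤ _ := (add_le_add h1 h2).trans (le_of_eq (add_comm _ _))

/-! ### The bilinear estimate for `S₂^{(m)}` -/

variable (K) in
/-- The error weight of a pair `(𝔡, 𝔢)` in the expansion of `S₂^{(m)}`: for compatible pairs with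
`𝔡_m = 𝔢_m = (1)` the class error plus the shift, `𝓔(N;𝔮) + C_s(N^{d−1}/N𝔮 + 1 + (N^d/N𝔮)^{1−1/d})`
(`𝔮 = 𝔴∏[𝔡ᵢ,𝔢ᵢ]`); for compatible pairs with `𝔡_m ≠ (1)` or `𝔢_m ≠ (1)` the generator count
`C_u (1 + log((2 + c)N))^{r}`; `0` for incompatible pairs.
[cite: CastilloEtAl2015, proof of Lemma 2.3 (display (eq:S2mainerror))] -/
def pairErr (k : ℕ) (𝔴 : Ideal (𝓞 K)) (h : Fin k → 𝓞 K) (N : ℝ) (m : Fin k) (C_s C_u : ℝ)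
    (𝔡 𝔢 : Fin k → Ideal (𝓞 K)) : ℝ :=
  if ∀ p : OffDiag k, 𝔡 p.1.1 ⊔ 𝔢 p.1.2 = ⊤ then
    (if 𝔡 m = ⊤ ∧ 𝔢 m = ⊤ then
      primesAErr K N (𝔴 * ∏ i, (𝔡 i ⊓ 𝔢 i)) +
        C_s * (N ^ (finrank ℚ K - 1) / Ideal.absNorm (𝔴 * ∏ i, (𝔡 i ⊓ 𝔢 i)) +
          (1 + (N ^ finrank ℚ K / Ideal.absNorm (𝔴 * ∏ i, (𝔡 i ⊓ 𝔢 i))) ^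
            (1 - 1 / (finrank ℚ K : ℝ))))
    else C_u * (1 + Real.log ((2 + CastilloEtAl2015.shiftConst K (h m)) * N)) ^ Units.rank K)
  else 0

omit [NumberField K] in
/-- `[𝔡ᵢ, 𝔢ᵢ] ≠ 0` for good `𝔡, 𝔢`. [folklore] -/
theorem inf_ne_bot_of_isGood {𝔴 : Ideal (𝓞 K)} {𝔡 𝔢 : Fin k → Ideal (𝓞 K)} (hd : IsGood 𝔴 𝔡)
    (he : IsGood 𝔴 𝔢) (i : Fin k) : 𝔡 i ⊓ 𝔢 i ≠ ⊥ := by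
  intro h0
  have hdi : 𝔡 i * 𝔢 i ≤ ⊥ := Ideal.mul_le_inf.trans (le_of_eq h0)
  rw [le_bot_iff, ← Ideal.zero_eq_bot, mul_eq_zero] at hdi
  rcases hdi with h | h
  · exact hd.ne_bot i (by rwa [Ideal.zero_eq_bot] at h)
  · exact he.ne_bot i (by rwa [Ideal.zero_eq_bot] at h)

/-- **Display (eq:S2mainerror)** (proof of Lemma 2.3, totally real `K`): with `Σ'` the restriction
to `(𝔡ᵢ, 𝔢ⱼ) = 1` (`i ≠ j`) and `λ^{(m)}_𝔡 = λ_𝔡 [𝔡_m = (1)]`,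
`|S₂^{(m)} − (|P(N)|/φ(𝔴)) Σ'_{𝔡,𝔢} λ^{(m)}_𝔡 λ^{(m)}_𝔢/∏ φ([𝔡ᵢ,𝔢ᵢ])| ≤ ∑_{𝔡,𝔢 good} |λ_𝔡 λ_𝔢| pairErr(𝔡,𝔢)`
(`N ≥ 1`, `𝔴 ≠ 0`, `(ν₀ + h_m) + 𝔴 = (1)`, every prime ideal containing some `hᵢ − hⱼ` divides `𝔴`).
[cite: CastilloEtAl2015, proof of Lemma 2.3, (eq:S2mainerror)] -/
theorem abs_S2_sub_bilinear_le [IsTotallyReal K] {𝔴 : Ideal (𝓞 K)} (h𝔴 : 𝔴 ≠ ⊥) {B : ℝ}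
    {y : (Fin k → Ideal (𝓞 K)) → ℝ} (hy : SupportedOn K k 𝔴 B y) {h : Fin k → 𝓞 K}
    (hh : ∀ i j, i ≠ j → ∀ P : Ideal (𝓞 K), P.IsPrime → h i - h j ∈ P → P ∣ 𝔴)
    {ν₀ : 𝓞 K} {m : Fin k} (hν₀ : Ideal.span {ν₀ + h m} ⊔ 𝔴 = ⊤)
    {C_s : ℝ} (hCs : ShiftBound K (h m) C_s) {C_u : ℝ} (hCu : GeneratorCount K C_u)
    {N : ℝ} (hN : 1 ≤ N) :
    |S2 K k 𝔴 B y h ν₀ N m - primesA K N / idealTotient K 𝔴 *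
        ∑ 𝔡 ∈ boxG K k 𝔴 B, ∑ 𝔢 ∈ boxG K k 𝔴 B,
          (if ∀ p : OffDiag k, 𝔡 p.1.1 ⊔ 𝔢 p.1.2 = ⊤ then
            lamM K k B y m 𝔡 * lamM K k B y m 𝔢 / ∏ i, idealTotient K (𝔡 i ⊓ 𝔢 i) else 0)| ≤
      ∑ 𝔡 ∈ boxG K k 𝔴 B, ∑ 𝔢 ∈ boxG K k 𝔴 B,
        |lam K k B y 𝔡| * |lam K k B y 𝔢| * pairErr K k 𝔴 h N m C_s C_u 𝔡 𝔢 := by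
  rw [S2_eq_sum_boxG hy h ν₀ N m, Finset.mul_sum, ← Finset.sum_sub_distrib]
  refine (Finset.abs_sum_le_sum_abs _ _).trans (Finset.sum_le_sum fun 𝔡 hd => ?_)
  rw [Finset.mul_sum, ← Finset.sum_sub_distrib]
  refine (Finset.abs_sum_le_sum_abs _ _).trans (Finset.sum_le_sum fun 𝔢 he => ?_)
  have hdG := (mem_boxG.1 hd).2
  have heG := (mem_boxG.1 he).2
  have hφ𝔴 : 0 < idealTotient K 𝔴 := idealTotient_pos h𝔴
  by_cases hc : ∀ p : OffDiag k, 𝔡 p.1.1 ⊔ 𝔢 p.1.2 = ⊤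
  · rw [if_pos hc, pairErr, if_pos hc]
    by_cases hdm : 𝔡 m = ⊤
    · by_cases hem : 𝔢 m = ⊤
      · rw [if_pos ⟨hdm, hem⟩, lamM_def, lamM_def, if_pos hdm, if_pos hem]
        have h1 := abs_cntP_sub_le h𝔴 hh hν₀ hCs hN hdG heG hc hdm hem
        obtain ⟨-, -, -, -, hLW, hLL⟩ := exists_crt_class h𝔴 hdG heG hc h ν₀
        -- `φ(𝔮) = φ(𝔴) ∏ φ([𝔡ᵢ, 𝔢ᵢ])`
        have hφ : idealTotient K (𝔴 * ∏ i, (𝔡 i ⊓ 𝔢 i)) =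
            idealTotient K 𝔴 * ∏ i, idealTotient K (𝔡 i ⊓ 𝔢 i) := by
          rw [idealTotient_mul_of_coprime _ _
              (Ideal.sup_prod_eq_top fun i _ => by rw [sup_comm]; exact hLW i),
            map_prod_of_pairwise (ρ := idealTotient K)
              (fun 𝔞 𝔟 h => idealTotient_mul_of_coprime 𝔞 𝔟 h) idealTotient_top Finset.univ
              (fun i => 𝔡 i ⊓ 𝔢 i) (fun i _ j _ hij => hLL i j hij)]
        have hP : 0 < ∏ i, idealTotient K (𝔡 i ⊓ 𝔢 i) :=
          Finset.prod_pos fun i _ => idealTotient_pos (inf_ne_bot_of_isGood hdG heG i)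
        rw [hφ] at h1
        have halg : lam K k B y 𝔡 * lam K k B y 𝔢 * (cntP K 𝔴 h ν₀ N m 𝔡 𝔢 : ℝ) -
            primesA K N / idealTotient K 𝔴 *
              (lam K k B y 𝔡 * lam K k B y 𝔢 / ∏ i, idealTotient K (𝔡 i ⊓ 𝔢 i)) =
            (lam K k B y 𝔡 * lam K k B y 𝔢) *
              ((cntP K 𝔴 h ν₀ N m 𝔡 𝔢 : ℝ) - primesA K N /
                (idealTotient K 𝔴 * ∏ i, idealTotient K (𝔡 i ⊓ 𝔢 i))) := by
          field_simp
        rw [halg, abs_mul, abs_mul]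
        exact mul_le_mul_of_nonneg_left h1 (by positivity)
      · rw [if_neg (fun h' => hem h'.2)]
        have hz : lamM K k B y m 𝔢 = 0 := by rw [lamM_def, if_neg hem]
        rw [hz, mul_zero, zero_div, mul_zero, sub_zero, abs_mul, abs_mul, Nat.abs_cast]
        exact mul_le_mul_of_nonneg_left (cntP_le_of_apply_ne_top' hCu 𝔴 h ν₀ hN m 𝔡 hem)
          (by positivity)
    · rw [if_neg (fun h' => hdm h'.1)]
      have hz : lamM K k B y m 𝔡 = 0 := by rw [lamM_def, if_neg hdm]
      rw [hz, zero_mul, zero_div, mul_zero, sub_zero, abs_mul, abs_mul, Nat.abs_cast]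
      exact mul_le_mul_of_nonneg_left (cntP_le_of_apply_ne_top hCu 𝔴 h ν₀ hN m hdm 𝔢)
        (by positivity)
  · rw [if_neg hc, pairErr, if_neg hc]
    push Not at hc
    obtain ⟨p, hp⟩ := hc
    rw [cntP_eq_zero_of_not_coprime hh ν₀ N m hdG hp]
    simp

/-- `pairErr ≥ 0` when `C_s, C_u` bound nonnegative quantities (as they do). [folklore] -/
theorem pairErr_nonneg [IsTotallyReal K] {𝔴 : Ideal (𝓞 K)} (h𝔴 : 𝔴 ≠ ⊥) (h : Fin k → 𝓞 K)
    {N : ℝ} (hN : 1 ≤ N) (m : Fin k) {C_s : ℝ} (hCs : ShiftBound K (h m) C_s) {C_u : ℝ}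
    (hCu : GeneratorCount K C_u) {𝔡 𝔢 : Fin k → Ideal (𝓞 K)} (hd : IsGood 𝔴 𝔡) (he : IsGood 𝔴 𝔢) :
    0 ≤ pairErr K k 𝔴 h N m C_s C_u 𝔡 𝔢 := by
  unfold pairErr
  split_ifs with hc hm
  · obtain ⟨a, -, hq0, -, -, -⟩ := exists_crt_class h𝔴 hd he hc h (0 : 𝓞 K)
    refine add_nonneg (primesAErr_nonneg _ _) ?_
    have hq0' : 𝔴 * ∏ i, (𝔡 i ⊓ 𝔢 i) ∈ (Ideal (𝓞 K))⁰ :=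
      mem_nonZeroDivisors_of_ne_zero (by rwa [Ne, Ideal.zero_eq_bot])
    have h1 := hCs ⟨_, hq0'⟩ N hN a
    simp only at h1
    exact le_trans (Nat.cast_nonneg _) h1
  · exact le_trans (Nat.cast_nonneg _) (cntP_le_of_apply_ne_top hCu 𝔴 h (0 : 𝓞 K) hN m
      (𝔡 := fun _ => ⊥) (by simp) 𝔢)
  · exact le_rfl

/-- **Castillo et al., Lemma 2.3, combinatorial form** (totally real `K`): if every prime ideal of
norm `2` divides `𝔴 ≠ 0`, `B ≥ 1`, `y` is supported on good tuples of the box with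
`|y^{(m)}_𝔲| ≤ y^{(m)}_max` on good `𝔲`, and the hypotheses of `abs_S2_sub_bilinear_le` hold, then
`|S₂^{(m)} − (|P(N)|/φ(𝔴)) ∑_𝔲 (y^{(m)}_𝔲)²/∏ g(𝔲ᵢ)| ≤ (|P(N)|/φ(𝔴)) (y^{(m)}_max)² L_g^{k−1}(Z_g^K − 1)
  + ∑_{𝔡,𝔢 good} |λ_𝔡 λ_𝔢| pairErr(𝔡, 𝔢)`
(display (eq:S2mainerror) plus the diagonalisation = `MaynardNFBilinear.abs_S2main_sub_le`); the
evaluation of the error terms (level of distribution, Euler products) is the sequel.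
[cite: CastilloEtAl2015, Lemma 2.3 and its proof] -/
theorem abs_S2_sub_main_le [IsTotallyReal K] {𝔴 : Ideal (𝓞 K)} (h𝔴 : 𝔴 ≠ ⊥)
    (h2 : ∀ P : Ideal (𝓞 K), Prime P → Ideal.absNorm P = 2 → P ∣ 𝔴) {B : ℝ} (hB : 1 ≤ B)
    {y : (Fin k → Ideal (𝓞 K)) → ℝ} (hy : SupportedOn K k 𝔴 B y) {m : Fin k} {ymmax : ℝ}
    (hym : ∀ 𝔲 ∈ boxG K k 𝔴 B, |ym K k 𝔴 B y m 𝔲| ≤ ymmax) {h : Fin k → 𝓞 K}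
    (hh : ∀ i j, i ≠ j → ∀ P : Ideal (𝓞 K), P.IsPrime → h i - h j ∈ P → P ∣ 𝔴)
    {ν₀ : 𝓞 K} (hν₀ : Ideal.span {ν₀ + h m} ⊔ 𝔴 = ⊤)
    {C_s : ℝ} (hCs : ShiftBound K (h m) C_s) {C_u : ℝ} (hCu : GeneratorCount K C_u)
    {N : ℝ} (hN : 1 ≤ N) :
    |S2 K k 𝔴 B y h ν₀ N m - primesA K N / idealTotient K 𝔴 *
        ∑ 𝔲 ∈ boxG K k 𝔴 B, ym K k 𝔴 B y m 𝔲 ^ 2 / ∏ i, gId K (𝔲 i)| ≤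
      primesA K N / idealTotient K 𝔴 *
          (ymmax ^ 2 * (∑ 𝔫 ∈ G1 K 𝔴 B, 1 / gId K 𝔫) ^ (k - 1) *
            ((∑ 𝔫 ∈ G1 K 𝔴 B, 1 / gId K 𝔫 ^ 2) ^ Fintype.card (OffDiag k) - 1)) +
        ∑ 𝔡 ∈ boxG K k 𝔴 B, ∑ 𝔢 ∈ boxG K k 𝔴 B,
          |lam K k B y 𝔡| * |lam K k B y 𝔢| * pairErr K k 𝔴 h N m C_s C_u 𝔡 𝔢 := by
  have h51 := abs_S2_sub_bilinear_le h𝔴 hy hh hν₀ hCs hCu hN (m := m) (k := k)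
  have hmain := abs_S2main_sub_le h2 hB y m hym (k := k)
  set X : ℝ := primesA K N / idealTotient K 𝔴 with hX
  have hX0 : 0 ≤ X := div_nonneg (Nat.cast_nonneg _) (idealTotient_pos h𝔴).le
  set Sp := ∑ 𝔡 ∈ boxG K k 𝔴 B, ∑ 𝔢 ∈ boxG K k 𝔴 B,
    (if ∀ p : OffDiag k, 𝔡 p.1.1 ⊔ 𝔢 p.1.2 = ⊤ then
      lamM K k B y m 𝔡 * lamM K k B y m 𝔢 / ∏ i, idealTotient K (𝔡 i ⊓ 𝔢 i) else 0) with hSp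
  set M := ∑ 𝔲 ∈ boxG K k 𝔴 B, ym K k 𝔴 B y m 𝔲 ^ 2 / ∏ i, gId K (𝔲 i) with hM
  have hsplit : S2 K k 𝔴 B y h ν₀ N m - X * M = X * (Sp - M) + (S2 K k 𝔴 B y h ν₀ N m - X * Sp) := by
    ring
  rw [hsplit]
  refine (abs_add_le _ _).trans (add_le_add ?_ h51)
  rw [abs_mul, abs_of_nonneg hX0]
  exact mul_le_mul_of_nonneg_left hmain hX0

end Literature.NumberTheory.Sieve.MaynardNF
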